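import Literature.IUT.HodgeArakelov.MonoThetaCyclotomesBridge
import Literature.AnabelianGeometry.EtaleTheta.ThetaEnvOfSetting

/-!
# Bridge B8, part 3: the [IUTchII] §1 setting over the GENUINE [EtTh] model of an [EtTh] §1 theta setting

abc-iut cell, MERGE-MAP §8 **B8** (layer L6 ↔ L2), continuation of `MonoThetaCyclotomesBridge`.
abc-iut-L2-t8's `EtaleThetaData.DoubleUnderline.thetaEnvData` (`ThetaEnvOfSetting.lean`, p407404) INSTANTIATES
t2's `ThetaEnvData N` from an [EtTh] §1 theta setting `D : EtaleTheta.ThetaSetting p` (a once-punctured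
Tate curve over a finite extension `K` of `ℚ_p` inside `ℚ̄_p`, with its tempered fundamental group), an étale
theta datum `E`, a choice `C : E.DoubleUnderline l` of `X̲̲` and a level-`N` cyclotome `μ`. This file fills the
`SideData` of `ThetaSetting.ofThetaEnvData` for THAT `ThetaEnvData`: `k := K` itself, `p :=` the residue
characteristic, `G_K ⊆ G_{ℚ_p}` with its Krull topology (the augmentation `Π^tp_{X̲̲} ↠ G_K` is then
continuous — PROVED), leaving as explicit hypotheses exactly the printed EXTRA assumptions of [IUTchII] §1
p. 20 over [EtTh]: "`l` an odd PRIME", "`p` odd, `p ≠ l`", "`k` contains a primitive `4l`-th root of unity".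
Result: `ThetaSetting.ofDoubleUnderline` — an [IUTchII] §1 setting whose reference model mono-theta
environment IS the [EtTh] Def. 2.13 (ii) model of the Tate curve — and, by part 2, every [IUTchII]-typed
mono-theta environment of it IS an [EtTh] mono-theta environment of `C.thetaEnvData μ hC hS`
(`isMonoThetaEnv_toEtale_ofDoubleUnderline`, unconditional).

HONEST FRAMING: bookkeeping only; [EtTh] is refereed, the [IUTchII] §1 p. 20 setting is typed record-only
[claim: Mochizuki2012, status: disputed] (IUTchII §1, kurims p.20); no side is taken on [IUTchIII] Cor. 3.12;
typed ≠ discharged. [cite: MochizukiEtTh2009, Def 2.13(ii) p.47]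
-/

noncomputable section

namespace Literature.IUT.HodgeArakelov

open Literature.AnabelianGeometry.EtaleTheta Literature.AnabelianGeometry.SemiGraphs
open scoped Literature.AnabelianGeometry.EtaleTheta

namespace ThetaSetting

variable {p : ℕ} [Fact p.Prime] {D : Literature.AnabelianGeometry.EtaleTheta.ThetaSetting p}
  {E : D.EtaleThetaData} {l : ℕ} (C : E.DoubleUnderline l) {N : ℕ+} (μ : D.CyclotomeMod l N)
  (hC : D.Compat) (hS : D.Sec2Hyps)

/-- The augmentation `Π^tp_{X̲̲} ↠ G_K` of L2-t8's instantiated `ThetaEnvData` is continuous for the Krull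
topology on `G_K ⊆ G_{ℚ_p}` (it is the co-restriction of the continuous `Π^tp_X → G_{ℚ_p}` to `Π^tp_{X̲̲}`).
[cite: MochizukiEtTh2009, Def 2.13 p.47] -/
theorem continuous_aug_thetaEnvData : Continuous (C.thetaEnvData μ hC hS).aug :=
  (D.aug.continuous.comp continuous_subtype_val).subtype_mk _

/-- **The side data of [IUTchII] §1 p. 20 over an [EtTh] §1 theta setting**: `k := K`, `p :=` the residue
characteristic, the cocycle `η` of the collection; the printed EXTRA hypotheses ("`l` an odd prime", "`p`
odd", "`p ≠ l`", "`k ∋` a primitive `4l`-th root of unity") are the explicit arguments.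
[claim: Mochizuki2012, status: disputed] (IUTchII §1, kurims p.20) -/
def SideData.ofDoubleUnderline (hl : l.Prime) (hp2 : p ≠ 2) (hpl : p ≠ l)
    (hζ : ∃ ζ : D.K, IsPrimitiveRoot ζ (4 * l)) {η : (C.thetaEnvData μ hC hS).PiYdd → MuN p N}
    (hη : η ∈ (C.thetaEnvData μ hC hS).thetaCocycles) : SideData (C.thetaEnvData μ hC hS) where
  l := l
  l_prime := hl
  l_odd := fun h => by have := C.l_odd; rw [h] at this; exact (Nat.not_odd_iff_even.2 even_two) this
  p := p
  p_prime := Fact.out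
  p_odd := hp2
  p_ne_l := hpl
  k := D.K
  hasPrimitiveRoot := hζ
  aug_continuous := continuous_aug_thetaEnvData C μ hC hS
  η := η
  mem := hη

/-- **The [IUTchII] §1 setting of the Tate curve `X̲̲_K`** determined by an [EtTh] §1 theta setting (+ the
printed extra hypotheses): its reference model mono-theta environment IS t2's `modelMono η` built from
L2-t8's `thetaEnvData`. [claim: Mochizuki2012, status: disputed] (IUTchII §1, kurims p.20) -/
def ofDoubleUnderline (hl : l.Prime) (hp2 : p ≠ 2) (hpl : p ≠ l)
    (hζ : ∃ ζ : D.K, IsPrimitiveRoot ζ (4 * l)) {η : (C.thetaEnvData μ hC hS).PiYdd → MuN p N}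
    (hη : η ∈ (C.thetaEnvData μ hC hS).thetaCocycles) : ThetaSetting.{0} :=
  ofThetaEnvData (C.thetaEnvData μ hC hS) (SideData.ofDoubleUnderline C μ hC hS hl hp2 hpl hζ hη)

/-- Its tempered fundamental group is `Π^tp_{X̲̲} = C.Huu` and its level is `N` (bookkeeping).
[claim: Mochizuki2012, status: disputed] (IUTchII §1, kurims p.20) -/
theorem ofDoubleUnderline_PiX_N (hl : l.Prime) (hp2 : p ≠ 2) (hpl : p ≠ l)
    (hζ : ∃ ζ : D.K, IsPrimitiveRoot ζ (4 * l)) {η : (C.thetaEnvData μ hC hS).PiYdd → MuN p N}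
    (hη : η ∈ (C.thetaEnvData μ hC hS).thetaCocycles) :
    ((ofDoubleUnderline C μ hC hS hl hp2 hpl hζ hη).PiX : Type) = C.Huu ∧
      (ofDoubleUnderline C μ hC hS hl hp2 hpl hζ hη).N = N := ⟨rfl, rfl⟩

/-- The reference model of `ofDoubleUnderline` IS the [EtTh] Def. 2.13 (ii) model `modelMono η` of the Tate
curve (equality of [EtTh] data on the nose). [cite: MochizukiEtTh2009, Def 2.13(ii) p.47] -/
theorem modelEnv_ofDoubleUnderline (hl : l.Prime) (hp2 : p ≠ 2) (hpl : p ≠ l)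
    (hζ : ∃ ζ : D.K, IsPrimitiveRoot ζ (4 * l)) {η : (C.thetaEnvData μ hC hS).PiYdd → MuN p N}
    (hη : η ∈ (C.thetaEnvData μ hC hS).thetaCocycles) :
    (ofDoubleUnderline C μ hC hS hl hp2 hpl hζ hη).modelEnv = (C.thetaEnvData μ hC hS).modelMono hη :=
  modelEnv_ofThetaEnvData _ _

/-- **Unconditional**: every [IUTchII]-typed mono-theta environment of the setting `ofDoubleUnderline` IS an
[EtTh] mono-theta environment (Def. 2.13 (ii), t2's `IsMonoThetaEnv`) of the Tate curve's `ThetaEnvData`.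
[cite: MochizukiEtTh2009, Def 2.13(ii) p.47] -/
theorem isMonoThetaEnv_toEtale_ofDoubleUnderline (hl : l.Prime) (hp2 : p ≠ 2) (hpl : p ≠ l)
    (hζ : ∃ ζ : D.K, IsPrimitiveRoot ζ (4 * l)) {η : (C.thetaEnvData μ hC hS).PiYdd → MuN p N}
    (hη : η ∈ (C.thetaEnvData μ hC hS).thetaCocycles)
    (M : MonoThetaEnv (ofDoubleUnderline C μ hC hS hl hp2 hpl hζ hη)) :
    (C.thetaEnvData μ hC hS).IsMonoThetaEnv M.toEtale :=
  isMonoThetaEnv_toEtale_ofThetaEnvData _ _ M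

/-- … and the [EtTh] model of the Tate curve underlies one of them (NON-VACUITY of
`MonoThetaEnv (ofDoubleUnderline …)` — the structure of [IUTchII] §1 Def. 1.1 is inhabited by the genuine
object). [cite: MochizukiEtTh2009, Def 2.13(ii) p.47] -/
theorem nonempty_monoThetaEnv_ofDoubleUnderline (hl : l.Prime) (hp2 : p ≠ 2) (hpl : p ≠ l)
    (hζ : ∃ ζ : D.K, IsPrimitiveRoot ζ (4 * l)) {η : (C.thetaEnvData μ hC hS).PiYdd → MuN p N}
    (hη : η ∈ (C.thetaEnvData μ hC hS).thetaCocycles) :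
    ∃ M : MonoThetaEnv (ofDoubleUnderline C μ hC hS hl hp2 hpl hζ hη),
      M.toEtale = (C.thetaEnvData μ hC hS).modelMono hη :=
  nonempty_monoThetaEnv_ofThetaEnvData _ _

/-- Modulo [EtTh] Cor. 2.18 (ii) (`Cor218_ii`, L2's named fact) for the Tate curve's `ThetaEnvData`:
t2's `IsMonoThetaEnv` = "underlies an [IUTchII]-typed `MonoThetaEnv` of `ofDoubleUnderline`".
[cite: MochizukiEtTh2009, Cor 2.18(ii) p.60] -/
theorem isMonoThetaEnv_iff_ofDoubleUnderline (hl : l.Prime) (hp2 : p ≠ 2) (hpl : p ≠ l)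
    (hζ : ∃ ζ : D.K, IsPrimitiveRoot ζ (4 * l)) {η : (C.thetaEnvData μ hC hS).PiYdd → MuN p N}
    (hη : η ∈ (C.thetaEnvData μ hC hS).thetaCocycles) (hT : (C.thetaEnvData μ hC hS).Cor218_ii)
    (M' : Literature.AnabelianGeometry.EtaleTheta.MonoThetaEnv.{0}) :
    (C.thetaEnvData μ hC hS).IsMonoThetaEnv M' ↔
      ∃ M : MonoThetaEnv (ofDoubleUnderline C μ hC hS hl hp2 hpl hζ hη), M.toEtale = M' :=
  isMonoThetaEnv_iff_ofThetaEnvData _ _ hT M'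

end ThetaSetting

end Literature.IUT.HodgeArakelov
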